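import Summits.QuantumAdvantage.QuantumAdvantage.Theorems.MobiusLadderLiouvilleMemBQP

/-!
# QuantumAdvantage / MobiusLadder — support `ShorToLiouville` (stmt-QuantumAdvantage-1401)

`Literature.Computability.Cryptography.factoring_mem_FBQP → LiouvilleMemBQP`: Shor's theorem in `FBQP` form
(on input `x` a poly-time uniform, oracle-free Clifford+T family writes, with probability `≥ 2/3`, a string
extending `code(primeFactorsList (decodeNat x))`) gives that the Liouville language
`L_λ = encodingNatBool.toLanguage {N : ℕ | λ(N) = −1}` (canonical LSB-first numerals of the `N` with `Ω(N)`
odd) is in the tree's strict class `BQP`.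

The construction — ONE classical wrap (`isQSolvable_classicalWrap_holds`, Bernstein–Vazirani 1997, §8) with
the identity pre-processor and the `FP` post-processor `⟨x, y⟩ ↦ [x is a canonical numeral ∧ |parseF y| is odd]`
assembled in the typed `CodeFP` algebra, then decision from search (`mem_BQP_of_isQSolvable_bit`), with the
arithmetic `λ(N) = −1 ↔ |primeFactorsList N| odd` — is the theorem `liouvilleMemBQP_of_factoring` of the
sibling file `Theorems/MobiusLadderLiouvilleMemBQP.lean` (item `LiouvilleMemBQP`, stmt-QuantumAdvantage-1400),
whose hypothesis is literally `factoring_mem_FBQP`; this file records that it is exactly the implication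
`ShorToLiouville`. Everything used is proved in the tree; no definition, no named fact.

## References

* P. W. Shor, *Polynomial-time algorithms for prime factorization and discrete logarithms on a quantum
  computer*, SIAM J. Comput. 26 (1997) 1484–1509, §5 [Shor1997].
* E. Bernstein, U. Vazirani, *Quantum complexity theory*, SIAM J. Comput. 26 (1997) 1411–1473, Def. 8 and §8
  [BernsteinVazirani1997].
-/

set_option linter.dupNamespace false -- D-0017: single-problem summit ⇒ `QuantumAdvantage.QuantumAdvantage` by design

namespace Summit.QuantumAdvantage.QuantumAdvantage.Theorems.MobiusLadder

open Literature.Computability.Cryptography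

/-- Settles `stmt-QuantumAdvantage-1401` (route MobiusLadder, support `ShorToLiouville`): **Shor's theorem in
`FBQP` form implies that the Liouville language `{bin(N) : λ(N) = −1}` is in `BQP`** — run the factoring
family, fold the classical post-processing (reject non-canonical inputs, in particular `[] = bin 0` since
`λ(0) = 0 ≠ −1`; accept iff the decoded factor list has odd length, `Ω(N)` odd `↔ λ(N) = −1` for `N ≠ 0`) into
the uniform family by one classical wrap, and read wire `0`: the theorem `liouvilleMemBQP_of_factoring`.
[cite: Shor1997, §5] [cite: BernsteinVazirani1997, Def. 8 and §8] -/
theorem shorToLiouville_proof :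
    Summit.QuantumAdvantage.QuantumAdvantage.Theses.MobiusLadder.ShorToLiouville := by
  unfold Summit.QuantumAdvantage.QuantumAdvantage.Theses.MobiusLadder.ShorToLiouville
    Summit.QuantumAdvantage.QuantumAdvantage.Theses.MobiusLadder.LiouvilleMemBQP
  exact liouvilleMemBQP_of_factoring

end Summit.QuantumAdvantage.QuantumAdvantage.Theorems.MobiusLadder
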